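import Mathlib
import Literature.Analysis.UnboundedOperators.DiagonalOperator
import Summits.NavierStokesRegularity.FluidComputer.SkewCutGalerkinMaster

/-!
# Truncation subspaces of a Hilbert basis: closedness, invariance under diagonal operators, and the
# head/tail dichotomy of basis vectors
(instab3 g5 — implementation 1 of the skew-cut X0 certifier, cell `ns-blowup`, 2026-08-26)

HONEST FRAMING (human ruling D-0035): nothing here is a claim about Navier–Stokes blow-up.
WHAT THIS IS NOT: not NS evidence; generic Hilbert-space bookkeeping. For a Hilbert basis `b` on `ι`
and a finite index set `F`, the HEAD truncation `U_F = closure (span {b_j : j ∈ F})` of the skew-cut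
X0 chain (`SkewCutGalerkinHead`, `SkewCutGalerkinTailForm.not_eigenvalue_of_structure`) is the span
itself (finite-dimensional, closed), the bounded diagonal operators `b.diagonalCLM d` preserve `U_F`
and `U_Fᗮ`, and every basis vector lies in `U_F` (index in `F`) or in `U_Fᗮ` (index outside `F`).
These are the STRUCTURAL hypotheses `hS₀U`, `hS₀U'`, `hhead` of `not_eigenvalue_of_structure` for
every coordinate instantiation of the chain (Craya coordinates of the full ABC operator —
`AbcCrayaAssembly`, `AbcCrayaHead` — or a class-II basis). Mathlib + the tree's `DiagonalOperator`
(`HilbertBasis.diagonalCLM`) + `SkewCutGalerkinMaster.inner_basis_diagonalCLM`; no definitions.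
-/

noncomputable section

open scoped InnerProductSpace
open Submodule

namespace Summit.NavierStokesRegularity.FluidComputer.HilbertBasisTruncation

variable {ι 𝕜 H : Type*} [RCLike 𝕜] [NormedAddCommGroup H] [InnerProductSpace 𝕜 H]
variable (b : HilbertBasis ι 𝕜 H)

/-- The span of finitely many basis vectors is finite-dimensional. -/
theorem finiteDimensional_span (F : Finset ι) : FiniteDimensional 𝕜 (span 𝕜 (b '' (F : Set ι))) :=
  FiniteDimensional.span_of_finite 𝕜 (F.finite_toSet.image _)

/-- **The head truncation is the span itself**: `closure (span {b_j : j ∈ F}) = span {b_j : j ∈ F}`. -/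
theorem truncation_eq_span (F : Finset ι) :
    (span 𝕜 (b '' (F : Set ι))).topologicalClosure = span 𝕜 (b '' (F : Set ι)) := by
  haveI := finiteDimensional_span b F
  exact (Submodule.closed_of_finiteDimensional _).submodule_topologicalClosure_eq

/-- Basis vectors with index in `F` lie in the head truncation. -/
theorem basis_mem_truncation {F : Finset ι} {i : ι} (hi : i ∈ F) :
    b i ∈ (span 𝕜 (b '' (F : Set ι))).topologicalClosure := by
  rw [truncation_eq_span]
  exact subset_span ⟨i, Finset.mem_coe.mpr hi, rfl⟩

/-- Basis vectors with index outside `F` are orthogonal to the head truncation. -/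
theorem basis_mem_truncation_orthogonal {F : Finset ι} {i : ι} (hi : i ∉ F) :
    b i ∈ (span 𝕜 (b '' (F : Set ι))).topologicalClosureᗮ := by
  rw [truncation_eq_span, Submodule.mem_orthogonal]
  intro y hy
  refine Submodule.span_induction (p := fun y _ => ⟪y, b i⟫_𝕜 = 0) ?_ ?_ ?_ ?_ hy
  · rintro _ ⟨j, hj, rfl⟩
    have hji : j ≠ i := fun h => hi (h ▸ Finset.mem_coe.mp hj)
    exact b.orthonormal.2 hji
  · exact inner_zero_left _
  · intro x y _ _ hx hy
    rw [inner_add_left, hx, hy, add_zero]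
  · intro a x _ hx
    rw [inner_smul_left, hx, mul_zero]

/-- **`hhead`**: every basis vector lies in the head truncation or in its orthogonal complement. -/
theorem basis_mem_truncation_or (F : Finset ι) (i : ι) :
    b i ∈ (span 𝕜 (b '' (F : Set ι))).topologicalClosure ∨
      b i ∈ (span 𝕜 (b '' (F : Set ι))).topologicalClosureᗮ := by
  classical
  by_cases hi : i ∈ F
  · exact Or.inl (basis_mem_truncation b hi)
  · exact Or.inr (basis_mem_truncation_orthogonal b hi)

/-- **`hS₀U`**: bounded diagonal operators preserve the head truncation (`diag(d) b_j = d_j b_j`). -/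
theorem diagonalCLM_mem_truncation (d : lp (fun _ : ι => 𝕜) ⊤) (F : Finset ι) {z : H}
    (hz : z ∈ (span 𝕜 (b '' (F : Set ι))).topologicalClosure) :
    b.diagonalCLM d z ∈ (span 𝕜 (b '' (F : Set ι))).topologicalClosure := by
  rw [truncation_eq_span] at hz ⊢
  refine Submodule.span_induction (p := fun y _ => b.diagonalCLM d y ∈ span 𝕜 (b '' (F : Set ι)))
    ?_ ?_ ?_ ?_ hz
  · rintro _ ⟨j, hj, rfl⟩
    rw [b.diagonalCLM_basis]
    exact Submodule.smul_mem _ _ (subset_span ⟨j, hj, rfl⟩)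
  · rw [map_zero]; exact Submodule.zero_mem _
  · intro x y _ _ hx hy
    rw [map_add]; exact Submodule.add_mem _ hx hy
  · intro a x _ hx
    rw [map_smul]; exact Submodule.smul_mem _ _ hx

/-- **`hS₀U'`**: bounded diagonal operators preserve the orthogonal complement of the head
truncation (`⟪b_j, diag(d) z⟫ = d_j ⟪b_j, z⟫ = 0` for `j ∈ F`, `z ⊥ U_F`). -/
theorem diagonalCLM_mem_truncation_orthogonal (d : lp (fun _ : ι => 𝕜) ⊤) (F : Finset ι) {z : H}
    (hz : z ∈ (span 𝕜 (b '' (F : Set ι))).topologicalClosureᗮ) :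
    b.diagonalCLM d z ∈ (span 𝕜 (b '' (F : Set ι))).topologicalClosureᗮ := by
  rw [truncation_eq_span] at hz ⊢
  rw [Submodule.mem_orthogonal] at hz ⊢
  intro y hy
  refine Submodule.span_induction (p := fun y _ => ⟪y, b.diagonalCLM d z⟫_𝕜 = 0) ?_ ?_ ?_ ?_ hy
  · rintro _ ⟨j, hj, rfl⟩
    rw [SkewCutGalerkinMaster.inner_basis_diagonalCLM, hz (b j) (subset_span ⟨j, hj, rfl⟩), mul_zero]
  · exact inner_zero_left _
  · intro x y _ _ hx hy
    rw [inner_add_left, hx, hy, add_zero]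
  · intro a x _ hx
    rw [inner_smul_left, hx, mul_zero]

/-- The head truncation has an orthogonal projection (it is complete, being finite-dimensional). -/
theorem hasOrthogonalProjection_truncation (F : Finset ι) :
    (span 𝕜 (b '' (F : Set ι))).topologicalClosure.HasOrthogonalProjection := by
  rw [truncation_eq_span]
  haveI := finiteDimensional_span b F
  infer_instance

end Summit.NavierStokesRegularity.FluidComputer.HilbertBasisTruncation

end
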